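import Literature.Computability.Complexity.Williams2014ConvCap
import Literature.Computability.Complexity.CodeFPLists
import Literature.Computability.Complexity.CodeFPBudgets
import HarnessLib

/-!
# The `ACC → SYM⁺` conversion is polynomial time on padded codes, I: tokens and gate polynomials

R. Williams, *Nonuniform ACC circuit lower bounds*, J. ACM 61 (2014), Lemma 4.1 / Appendix A:
"The algorithm takes at most `s^{O(log^{f(d)} s)}` time." In the tree the time bound is the
membership of the budgeted conversion `convCodeB` (`Williams2014ConvCap.lean`) in the typed calculus
`CodeFP` of polynomial-time maps on codes (`CodeFP*.lean`), on inputs `⟨code, 1^B⟩`. This file derives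
the first half: the generic bricks (`natSum`, the capped fold `foldlCap`), the codes of tokens and
the token builders (`oneSubToks`, `sumLToks`, `prodLToks`, `powToks`), the source-literal table
`srcTableC`, the literal tokens `litToksC`, the budgeted seed test `vvSeedB`, the `q`-subset tables
(`sublistsLen` by its front recursion as a fold), and the tokens of the gate polynomials
(`andToksB`, `orToksB`, `modToksC`, `esymToksC`, `auxToksC`, `ffToksB`).

No new named fact; everything is proved.

## References

* R. Williams, *Nonuniform ACC circuit lower bounds*, J. ACM 61 (2014), Lemma 4.1, Appendix A
  [Williams2014].
* S. Arora, B. Barak, *Computational Complexity: A Modern Approach*, CUP 2009, §1.3 (polynomial-time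
  closure under composition and bounded loops) [AroraBarak2009].
-/

noncomputable section

namespace Literature.Computability.Complexity

open _root_.Computability Polynomial CodeFP Brick SatCode

namespace BT

variable {α β γ σ : Type} {eα : α → List Bool} {eβ : β → List Bool} {eγ : γ → List Bool} {eσ : σ → List Bool}

/-! ### Generic bricks -/

/-- Sums of lists of naturals. [folklore] -/
theorem natSum : CodeFP (rawE natE) natE List.sum := by
  have h := intToNat.comp (intSum.comp (map₀ intOfNat))
  refine h.congr fun l => ?_
  show ((l.map fun n : ℕ => (n : ℤ)).sum).toNat = l.sum
  rw [← Nat.cast_list_sum, Int.toNat_natCast]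

/-- The code of a computed value as a string. [folklore] -/
theorem codeStr {g : α → β} (hg : CodeFP eα eβ g) : CodeFP eα strE (fun a => eβ (g a)) :=
  hg.recodeOut fun _ => rfl

/-- **The capped fold**: a fold whose accumulator is reset to a default as soon as its code would
exceed the budget `bud` (read off the context, at most the context's code length) is in `CodeFP`
— whatever the step. [cite: AroraBarak2009, §1.3] -/
theorem foldlCap {step : σ → α → β → β} {init : σ → β} {bud : σ → ℕ} (dflt : β)
    (hstep : CodeFP (pairE eσ (pairE eα eβ)) eβ (fun t => step t.1 t.2.1 t.2.2))
    (hinit : CodeFP eσ eβ init) (hbud : CodeFP eσ unE bud) (hbudle : ∀ s, bud s ≤ (eσ s).length) :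
    CodeFP (pairE eσ (rawE eα)) eβ
      (fun p => p.2.foldl (fun b a => capTo eβ (bud p.1) dflt (step p.1 a b)) (init p.1)) := by
  obtain ⟨P, hP⟩ := exists_poly_length_le_of_mem_FP hinit.choose_spec.1
  have hPinit : ∀ s, (eβ (init s)).length ≤ P.eval (eσ s).length := fun s => by
    have := hP (eσ s); rwa [hinit.choose_spec.2] at this
  have hlen := strLength.comp (codeStr hstep)
  have hb : CodeFP (pairE eσ (pairE eα eβ)) unE (fun t => bud t.1) := (hbud.comp (fst _ _)).congr fun _ => rfl
  have hcond := natLe.comp ((natOfUn.comp hlen).pair (natOfUn.comp hb))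
  have hstep' : CodeFP (pairE eσ (pairE eα eβ)) eβ
      (fun t => capTo eβ (bud t.1) dflt (step t.1 t.2.1 t.2.2)) :=
    (hcond.ite hstep (const _ dflt)).congr fun t => by simp [capTo]
  refine CodeFP.foldl (step := fun s a b => capTo eβ (bud s) dflt (step s a b)) (init := init)
    hstep' hinit (P + X + C (eβ dflt).length) fun s l₁ l₂ => ?_
  have hacc : ∀ l : List α, (eβ (l.foldl (fun b a => capTo eβ (bud s) dflt (step s a b)) (init s))).length ≤
      max (eβ (init s)).length (max (bud s) (eβ dflt).length) := by
    intro l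
    induction l using List.reverseRecOn with
    | nil => exact le_max_left _ _
    | append_singleton l a ih =>
      rw [List.foldl_append, List.foldl_cons, List.foldl_nil, capTo]
      split_ifs with h
      · exact h.trans ((le_max_left _ _).trans (le_max_right _ _))
      · exact (le_max_right _ _).trans (le_max_right _ _)
  refine (hacc l₁).trans ?_
  simp only [eval_add, eval_X, eval_C, pairE_apply, length_boolPair]
  have h1 := hPinit s
  have h2 := hbudle s
  have h3 : P.eval (eσ s).length ≤ P.eval (2 * (eσ s).length + 2 + (rawE eα (l₁ ++ l₂)).length) :=
    TM2Iter.eval_mono P (by omega)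
  omega

/-- The capped iteration: `κ` rounds of a capped step. [cite: AroraBarak2009, §1.3] -/
theorem iterCap {f : σ → β → β} {init : σ → β} {bud rounds : σ → ℕ} (dflt : β)
    (hf : CodeFP (pairE eσ eβ) eβ (fun t => f t.1 t.2)) (hinit : CodeFP eσ eβ init)
    (hbud : CodeFP eσ unE bud) (hbudle : ∀ s, bud s ≤ (eσ s).length) (hrounds : CodeFP eσ unE rounds) :
    CodeFP eσ eβ (fun s => (List.replicate (rounds s) ()).foldl (fun b _ => capTo eβ (bud s) dflt (f s b)) (init s)) := by
  have h := foldlCap (α := Unit) (eα := unitE) (step := fun s (_ : Unit) b => f s b) dflt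
    (hf.comp ((fst _ _).pair (snd _ _).snd')) hinit hbud hbudle
  exact (h.comp ((CodeFP.id eσ).pair (replicateUnit.comp hrounds))).congr fun _ => rfl

/-- Binary exponent capped by a unary budget: `(1^B, b, e) ↦ b ^ min B e`. [folklore] -/
theorem cpow : CodeFP (pairE unE (pairE natE natE)) natE (fun p => p.2.1 ^ min p.2.2 p.1) :=
  (natPow.comp ((snd unE (pairE natE natE)).fst'.pair (unOfNatMin.comp ((fst unE (pairE natE natE)).pair
    (snd unE (pairE natE natE)).snd')))).congr fun _ => rfl

/-- A fixed polynomial-free power: `x ↦ x ^ e` for a numeral `e`. [folklore] -/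
theorem natPowConst (e : ℕ) : CodeFP natE natE (fun x => x ^ e) :=
  (natPow.comp ((CodeFP.id natE).pair (const natE e))).congr fun _ => rfl

/-! ### Codes of tokens -/

/-- Reading a token as its tuple. [folklore] -/
theorem tokTuple_code : CodeFP tokE tupE tokTuple := transparent fun _ => rfl

/-- The tag of a token. [folklore] -/
theorem tokTag_code : CodeFP tokE natE (fun t => (tokTuple t).1) := tokTuple_code.fst'

/-- Input tokens from their index. [folklore] -/
theorem tokInp_code : CodeFP natE tokE Tok.inp := by
  have h0 : CodeFP natE natE (fun _ => (0 : ℕ)) := const natE (0 : ℕ)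
  have hz : CodeFP natE (pairE natE (pairE natE intE)) (fun _ => ((0 : ℕ), (0 : ℕ), (0 : ℤ))) := const natE _
  have h : CodeFP natE tupE (fun i => ((0 : ℕ), i, (0 : ℕ), (0 : ℕ), (0 : ℤ))) :=
    (h0.pair ((CodeFP.id natE).pair hz)).congr fun _ => rfl
  exact h.recodeOut fun _ => rfl

/-- Variable tokens from `(c, j, q)`. [folklore] -/
theorem tokGv_code : CodeFP (pairE natE (pairE natE natE)) tokE (fun p => Tok.gv p.1 p.2.1 p.2.2) := by
  have h1 : CodeFP (pairE natE (pairE natE natE)) natE (fun _ => (1 : ℕ)) := const _ (1 : ℕ)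
  have hc : CodeFP (pairE natE (pairE natE natE)) natE (fun p => p.1) := fst natE (pairE natE natE)
  have hj : CodeFP (pairE natE (pairE natE natE)) natE (fun p => p.2.1) := (snd natE (pairE natE natE)).fst'
  have hq : CodeFP (pairE natE (pairE natE natE)) natE (fun p => p.2.2) := (snd natE (pairE natE natE)).snd'
  have hz : CodeFP (pairE natE (pairE natE natE)) intE (fun _ => (0 : ℤ)) := const _ (0 : ℤ)
  have h : CodeFP (pairE natE (pairE natE natE)) tupE (fun p => ((1 : ℕ), p.1, p.2.1, p.2.2, (0 : ℤ))) :=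
    (h1.pair (hc.pair (hj.pair (hq.pair hz)))).congr fun _ => rfl
  exact h.recodeOut fun _ => rfl

/-- `tokE` is injective. [folklore] -/
theorem tokE_injective : Function.Injective tokE := fun _ _ h =>
  tokTuple_injective (pairE_injective natE_injective (pairE_injective natE_injective
    (pairE_injective natE_injective (pairE_injective natE_injective intE_injective))) h)

/-! ### Token builders -/

/-- `oneSubToks` on codes. [folklore] -/
theorem oneSubToks_code : CodeFP toksE toksE oneSubToks :=
  ((rawAppend tokE).comp ((const toksE [Tok.cst 1, Tok.cst (-1)]).pair ((rawAppend tokE).comp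
    ((CodeFP.id toksE).pair (const toksE [Tok.mul, Tok.add]))))).congr fun f => by
    simp [oneSubToks]

/-- `sumLToks` on codes. [folklore] -/
theorem sumLToks_code : CodeFP (rawE toksE) toksE sumLToks :=
  ((rawAppend tokE).comp ((flatten tokE).pair ((rawCons tokE).comp ((const _ (Tok.cst 0)).pair
    ((replicateOf tokE).comp ((const _ Tok.add).pair (ulength toksE))))))).congr fun _ => rfl

/-- `prodLToks` on codes. [folklore] -/
theorem prodLToks_code : CodeFP (rawE toksE) toksE prodLToks :=
  ((rawAppend tokE).comp ((flatten tokE).pair ((rawCons tokE).comp ((const _ (Tok.cst 1)).pair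
    ((replicateOf tokE).comp ((const _ Tok.mul).pair (ulength toksE))))))).congr fun _ => rfl

/-- `powToks e` on codes, for a numeral `e`. [folklore] -/
theorem powToks_code (e : ℕ) : CodeFP toksE toksE (powToks e) :=
  ((rawAppend tokE).comp (((flatten tokE).comp ((replicateOf toksE).comp ((CodeFP.id toksE).pair (const _ e)))).pair
    (const toksE (Tok.cst 1 :: List.replicate e Tok.mul)))).congr fun _ => rfl

/-- `todaToks` on codes. [folklore] -/
theorem todaToks_code : CodeFP toksE toksE todaToks := by
  have f : CodeFP toksE toksE (fun f => f) := CodeFP.id toksE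
  have app := rawAppend tokE
  have h1 : CodeFP toksE toksE (fun f => f ++ (f ++ [Tok.mul]) ++ [Tok.mul]) :=
    (app.comp ((app.comp (f.pair (app.comp (f.pair (const toksE [Tok.mul]))))).pair (const toksE [Tok.mul]))).congr
      fun _ => rfl
  have h2 : CodeFP toksE toksE (fun f => f ++ (f ++ (f ++ [Tok.mul]) ++ [Tok.mul]) ++ [Tok.mul]) :=
    (app.comp ((app.comp (f.pair h1)).pair (const toksE [Tok.mul]))).congr fun _ => rfl
  have h := app.comp (((rawCons tokE).comp ((const _ (Tok.cst 3)).pair h1)).pair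
    ((app.comp (((rawCons tokE).comp ((const _ (Tok.cst (-2))).pair h2)).pair (const toksE [Tok.add])))))
  exact h.congr fun _ => rfl

/-! ### The source-literal table and the literal tokens -/

/-- `srcEntry` on codes (table, gate code). [folklore] -/
theorem srcEntry_code : CodeFP (pairE srcE gateE) (pairE bitE wireE) (fun p => srcEntry p.1 p.2) := by
  have hacc : CodeFP (pairE srcE gateE) srcE (fun p => p.1) := fst _ _
  have hcode : CodeFP (pairE srcE gateE) natE (fun p => p.2.1) := (snd _ _).fst'
  have hws : CodeFP (pairE srcE gateE) (rawE wireE) (fun p => p.2.2) := (snd _ _).snd'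
  have hw : CodeFP (pairE srcE gateE) wireE (fun p => p.2.2.headD (2, 0)) :=
    ((rawHeadOr wireE).comp ((const _ ((2 : ℕ), (0 : ℕ))).pair hws)).congr fun _ => rfl
  have hlen : CodeFP (pairE srcE gateE) natE (fun p => p.1.length) := ((natLength _).comp hacc).congr fun _ => rfl
  have hget : CodeFP (pairE srcE gateE) (pairE bitE wireE) (fun p => p.1.getD (p.2.2.headD (2, 0)).2 (false, (0, 0))) :=
    ((rawGetOr (pairE bitE wireE)).comp (hacc.pair (hw.snd'.pair (const _ (false, ((0 : ℕ), (0 : ℕ))))))).congr fun _ => rfl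
  have hself : CodeFP (pairE srcE gateE) (pairE bitE wireE) (fun p => (false, ((1 : ℕ), p.1.length))) :=
    ((const _ false).pair ((const _ (1 : ℕ)).pair hlen)).congr fun _ => rfl
  have hinp : CodeFP (pairE srcE gateE) (pairE bitE wireE) (fun p => (true, ((0 : ℕ), (p.2.2.headD (2, 0)).2))) :=
    ((const _ true).pair ((const _ (0 : ℕ)).pair hw.snd')).congr fun _ => rfl
  have hflip : CodeFP (pairE srcE gateE) (pairE bitE wireE) (fun p =>
      (!(p.1.getD (p.2.2.headD (2, 0)).2 (false, (0, 0))).1, (p.1.getD (p.2.2.headD (2, 0)).2 (false, (0, 0))).2)) :=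
    (hget.fst'.not.pair hget.snd').congr fun _ => rfl
  have hc0 := natEq.comp (hcode.pair (const _ (0 : ℕ)))
  have ht0 := natEq.comp (hw.fst'.pair (const _ (0 : ℕ)))
  have ht1 := (natEq.comp (hw.fst'.pair (const _ (1 : ℕ)))).and (natLt.comp (hw.snd'.pair hlen))
  have h := hc0.ite (ht0.ite hinp (ht1.ite hflip hself)) hself
  exact h.congr fun p => by simp [srcEntry]

/-- **Invariant of the source table**: every entry has tag `≤ 1` and an index that is a position
of the table or the first wire index of one of the gates read. [folklore] -/
theorem srcTable_inv (gs : List GateC) : ∀ e ∈ srcTableC gs,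
    e.2.1 ≤ 1 ∧ (e.2.2 ≤ gs.length ∨ ∃ g ∈ gs, e.2.2 = (g.2.headD (2, 0)).2) := by
  induction gs using List.reverseRecOn with
  | nil => simp [srcTableC]
  | append_singleton gs g ih =>
    intro e he
    have hfold : srcTableC (gs ++ [g]) = srcTableC gs ++ [srcEntry (srcTableC gs) g] := by
      simp [srcTableC, List.foldl_append]
    rw [hfold, List.mem_append, List.mem_singleton] at he
    have hmono : ∀ e : Bool × WireC, (e.2.1 ≤ 1 ∧ (e.2.2 ≤ gs.length ∨ ∃ g' ∈ gs, e.2.2 = (g'.2.headD (2, 0)).2)) →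
        e.2.1 ≤ 1 ∧ (e.2.2 ≤ (gs ++ [g]).length ∨ ∃ g' ∈ gs ++ [g], e.2.2 = (g'.2.headD (2, 0)).2) := by
      rintro e ⟨h1, h2⟩
      refine ⟨h1, ?_⟩
      rcases h2 with h2 | ⟨g', hg', h2⟩
      · left; rw [List.length_append, List.length_singleton]; omega
      · right; exact ⟨g', List.mem_append_left _ hg', h2⟩
    rcases he with he | rfl
    · exact hmono e (ih e he)
    · have hlen : (srcTableC gs).length ≤ gs.length := by
        clear ih hmono hfold
        induction gs using List.reverseRecOn with
        | nil => simp [srcTableC]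
        | append_singleton gs g' ih => simp [srcTableC, List.foldl_append] at ih ⊢; omega
      unfold srcEntry
      split_ifs with h0 h1 h2
      · exact ⟨Nat.zero_le _, Or.inr ⟨g, by simp, rfl⟩⟩
      · refine hmono _ ⟨?_, ?_⟩
        · have hlt : (g.2.headD (2, 0)).2 < (srcTableC gs).length := h2.2
          rw [List.getD_eq_getElem _ _ hlt]
          exact (ih _ (List.getElem_mem hlt)).1
        · have hlt : (g.2.headD (2, 0)).2 < (srcTableC gs).length := h2.2
          rw [List.getD_eq_getElem _ _ hlt]
          exact (ih _ (List.getElem_mem hlt)).2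
      · refine ⟨le_rfl, Or.inl ?_⟩
        show (srcTableC gs).length ≤ (gs ++ [g]).length
        rw [List.length_append]; omega
      · refine ⟨le_rfl, Or.inl ?_⟩
        show (srcTableC gs).length ≤ (gs ++ [g]).length
        rw [List.length_append]; omega

/-- The source table has one entry per gate. [folklore] -/
theorem length_srcTableC (gs : List GateC) : (srcTableC gs).length = gs.length := by
  induction gs using List.reverseRecOn with
  | nil => rfl
  | append_singleton gs g ih => simp [srcTableC, List.foldl_append] at ih ⊢; omega

/-- **`srcTableC` on codes** (a fold; the table holds one short entry per gate read). [folklore] -/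
theorem srcTableC_code : CodeFP (rawE gateE) srcE srcTableC := by
  have hstep := ((rawAppend (pairE bitE wireE)).comp ((snd gateE srcE).pair ((rawSingleton _).comp
    (srcEntry_code.comp ((snd gateE srcE).pair (fst gateE srcE))))))
  have h := foldl₀ (eα := gateE) (eβ := srcE) (step := fun (g : GateC) (acc : List (Bool × WireC)) => acc ++ [srcEntry acc g])
    (b₀ := []) hstep (X * (2 * X + 22)) (fun l₁ l₂ => by
      have hfold : l₁.foldl (fun (acc : List (Bool × WireC)) (g : GateC) => acc ++ [srcEntry acc g]) [] = srcTableC l₁ := rfl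
      rw [hfold]
      set L := (rawE gateE (l₁ ++ l₂)).length with hL
      have hl₁ : l₁.length ≤ L := by
        have := length_le_length_rawE gateE (l₁ ++ l₂)
        rw [List.length_append] at this; omega
      have hitem : ∀ e ∈ srcTableC l₁, 2 * (pairE bitE wireE e).length + 2 ≤ 2 * L + 22 := by
        intro e he
        obtain ⟨h1, h2⟩ := srcTable_inv l₁ e he
        have hi : (natE e.2.2).length ≤ L := by
          rcases h2 with h2 | ⟨g, hg, h2⟩
          · exact (length_natE_le _).trans (h2.trans hl₁)
          · rw [h2]
            have hg' : g ∈ l₁ ++ l₂ := List.mem_append_left _ hg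
            have hgate := length_item_le_length_rawE gateE hg'
            rcases hw : g.2 with _ | ⟨w, ws⟩
            · simp
            · have hwmem : w ∈ g.2 := by rw [hw]; simp
              have h3 := length_item_le_length_rawE wireE hwmem
              have h4 : (wireE w).length = 2 * (natE w.1).length + 2 + (natE w.2).length := by
                show (pairE natE natE w).length = _; rw [pairE_apply, length_boolPair]
              have h5 : (gateE g).length = 2 * (natE g.1).length + 2 + (rawE wireE g.2).length := by
                show (pairE natE (rawE wireE) g).length = _; rw [pairE_apply, length_boolPair]
              simp only [List.headD_cons]
              omega
        have ht : (natE e.2.1).length ≤ 1 := (length_natE_le _).trans h1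
        have he' : (pairE bitE wireE e).length = 2 * 1 + 2 + (2 * (natE e.2.1).length + 2 + (natE e.2.2).length) := by
          rw [pairE_apply, length_boolPair]
          show 2 * (bitE e.1).length + 2 + (pairE natE natE e.2).length = _
          rw [pairE_apply, length_boolPair]; rfl
        omega
      rw [length_rawE]
      have hsum := List.sum_le_card_nsmul _ _ (fun y hy => by
        obtain ⟨e, he, rfl⟩ := List.mem_map.1 hy
        exact hitem e he)
      rw [List.length_map, length_srcTableC, smul_eq_mul] at hsum
      simp only [eval_mul, eval_add, eval_X, eval_ofNat]
      exact hsum.trans (Nat.mul_le_mul_right _ hl₁))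
  exact h.congr fun l => rfl

/-- `baseToksC` on codes. [folklore] -/
theorem baseToksC_code : CodeFP (pairE natE wireE) toksE (fun p => baseToksC p.1 p.2) := by
  have hc : CodeFP (pairE natE wireE) natE (fun p => p.1) := fst _ _
  have ht : CodeFP (pairE natE wireE) natE (fun p => p.2.1) := (snd _ _).fst'
  have hi : CodeFP (pairE natE wireE) natE (fun p => p.2.2) := (snd _ _).snd'
  have hinp := (rawSingleton tokE).comp (tokInp_code.comp hi)
  have hgv := (rawSingleton tokE).comp (tokGv_code.comp (hc.pair (hi.pair (const _ (0 : ℕ)))))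
  have h := (natEq.comp (ht.pair (const _ (0 : ℕ)))).ite hinp hgv
  exact h.congr fun p => by by_cases h0 : p.2.1 = 0 <;> simp [baseToksC, h0]

/-- **`litToksC` on codes** (table, copy, wire). [folklore] -/
theorem litToksC_code : CodeFP (pairE srcE (pairE natE wireE)) toksE (fun p => litToksC p.1 p.2.1 p.2.2) := by
  have hsrc : CodeFP (pairE srcE (pairE natE wireE)) srcE (fun p => p.1) := fst _ _
  have hc : CodeFP (pairE srcE (pairE natE wireE)) natE (fun p => p.2.1) := (snd _ _).fst'
  have ht : CodeFP (pairE srcE (pairE natE wireE)) natE (fun p => p.2.2.1) := (snd _ _).snd'.fst'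
  have hi : CodeFP (pairE srcE (pairE natE wireE)) natE (fun p => p.2.2.2) := (snd _ _).snd'.snd'
  have hget : CodeFP (pairE srcE (pairE natE wireE)) (pairE bitE wireE)
      (fun p => p.1.getD p.2.2.2 (false, (1, p.2.2.2))) :=
    ((rawGetOr (pairE bitE wireE)).comp (hsrc.pair (hi.pair ((const _ false).pair ((const _ (1 : ℕ)).pair hi))))).congr
      fun _ => rfl
  have hbase := baseToksC_code.comp (hc.pair hget.snd')
  have hinp := (rawSingleton tokE).comp (tokInp_code.comp hi)
  have h := (natEq.comp (ht.pair (const _ (0 : ℕ)))).ite hinp (hget.fst'.ite (oneSubToks_code.comp hbase) hbase)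
  exact h.congr fun p => by
    simp only [litToksC]
    by_cases h0 : p.2.2.1 = 0
    · simp [h0]
    · simp [h0]

/-! ### The budgeted seed test -/

/-- `bitNB` on codes: `(1^B, c, i) ↦ c / 2^{min B i} mod 2`. [folklore] -/
theorem bitNB_code : CodeFP (pairE unE (pairE natE natE)) natE (fun p => bitNB p.1 p.2.1 p.2.2) := by
  have hB : CodeFP (pairE unE (pairE natE natE)) unE (fun p => p.1) := fst _ _
  have hc : CodeFP (pairE unE (pairE natE natE)) natE (fun p => p.2.1) := (snd _ _).fst'
  have hi : CodeFP (pairE unE (pairE natE natE)) natE (fun p => p.2.2) := (snd _ _).snd'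
  have hpow := cpow.comp (hB.pair ((const _ (2 : ℕ)).pair hi))
  have h := natMod.comp ((natDiv.comp (hc.pair hpow)).pair (const _ (2 : ℕ)))
  exact h.congr fun _ => rfl

/-- The context of a row sum: `(1^B, μ, c, r, ρ, a)`. [folklore] -/
abbrev rowCtxE : ℕ × ℕ × ℕ × ℕ × ℕ × ℕ → List Bool := pairE unE (pairE natE (pairE natE (pairE natE (pairE natE natE))))

/-- `vvRowSumB` on codes. [folklore] -/
theorem vvRowSumB_code : CodeFP rowCtxE natE (fun p => vvRowSumB p.1 p.2.1 p.2.2.1 p.2.2.2.1 p.2.2.2.2.1 p.2.2.2.2.2) := by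
  have hB : CodeFP rowCtxE unE (fun p => p.1) := fst _ _
  have hmu : CodeFP rowCtxE natE (fun p => p.2.1) := (snd _ _).fst'
  have hc : CodeFP rowCtxE natE (fun p => p.2.2.1) := (snd _ _).snd'.fst'
  have hr : CodeFP rowCtxE natE (fun p => p.2.2.2.1) := (snd _ _).snd'.snd'.fst'
  have hρ : CodeFP rowCtxE natE (fun p => p.2.2.2.2.1) := (snd _ _).snd'.snd'.snd'.fst'
  have ha : CodeFP rowCtxE natE (fun p => p.2.2.2.2.2) := (snd _ _).snd'.snd'.snd'.snd'
  -- the base index `(r (μ+2) + ρ) (μ+1)`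
  have hbase : CodeFP rowCtxE natE (fun p => (p.2.2.2.1 * (p.2.1 + 2) + p.2.2.2.2.1) * (p.2.1 + 1)) :=
    (natMul.comp ((natAdd.comp ((natMul.comp (hr.pair (natAdd.comp (hmu.pair (const _ (2 : ℕ)))))).pair hρ)).pair
      (natAdd.comp (hmu.pair (const _ (1 : ℕ)))))).congr fun _ => rfl
  -- the summand at `i` (context, i)
  have hB' : CodeFP (pairE rowCtxE natE) unE (fun t => t.1.1) := (fst _ _).fst'
  have hi : CodeFP (pairE rowCtxE natE) natE (fun t => t.2) := snd _ _
  have hterm : CodeFP (pairE rowCtxE natE) natE (fun t =>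
      bitNB t.1.1 t.1.2.2.1 ((t.1.2.2.2.1 * (t.1.2.1 + 2) + t.1.2.2.2.2.1) * (t.1.2.1 + 1) + t.2) * bitNB t.1.1 t.1.2.2.2.2.2 t.2) :=
    (natMul.comp ((bitNB_code.comp (hB'.pair ((hc.comp (fst _ _)).pair (natAdd.comp ((hbase.comp (fst _ _)).pair hi))))).pair
      (bitNB_code.comp (hB'.pair ((ha.comp (fst _ _)).pair hi))))).congr fun _ => rfl
  have hrange : CodeFP rowCtxE (rawE natE) (fun p => List.range (min p.2.1 p.1)) := (rangeOf.comp (hB.pair hmu)).congr fun _ => rfl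
  have hsum := natSum.comp ((map hterm).comp ((CodeFP.id rowCtxE).pair hrange))
  have hlast := bitNB_code.comp (hB.pair (hc.pair (natAdd.comp (hbase.pair hmu))))
  have h := natAdd.comp (hsum.pair hlast)
  exact h.congr fun _ => rfl

/-- The context of a seed test: `(1^B, μ, c, t, a)`. [folklore] -/
abbrev seedCtxE : ℕ × ℕ × ℕ × ℕ × ℕ → List Bool := pairE unE (pairE natE (pairE natE (pairE natE natE)))

/-- **`vvSeedB` on codes.** [folklore] -/
theorem vvSeedB_code : CodeFP seedCtxE bitE (fun p => vvSeedB p.1 p.2.1 p.2.2.1 p.2.2.2.1 p.2.2.2.2) := by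
  have hB : CodeFP seedCtxE unE (fun p => p.1) := fst _ _
  have hmu : CodeFP seedCtxE natE (fun p => p.2.1) := (snd _ _).fst'
  have hc : CodeFP seedCtxE natE (fun p => p.2.2.1) := (snd _ _).snd'.fst'
  have ht : CodeFP seedCtxE natE (fun p => p.2.2.2.1) := (snd _ _).snd'.snd'.fst'
  have ha : CodeFP seedCtxE natE (fun p => p.2.2.2.2) := (snd _ _).snd'.snd'.snd'
  have hK : CodeFP seedCtxE natE (fun p => p.2.1 + 3) := (natAdd.comp (hmu.pair (const _ (3 : ℕ)))).congr fun _ => rfl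
  have hr : CodeFP seedCtxE natE (fun p => p.2.2.2.1 / (p.2.1 + 3)) := (natDiv.comp (ht.pair hK)).congr fun _ => rfl
  have hk : CodeFP seedCtxE natE (fun p => p.2.2.2.1 % (p.2.1 + 3)) := (natMod.comp (ht.pair hK)).congr fun _ => rfl
  have hrange : CodeFP seedCtxE (rawE natE) (fun p => List.range (min (p.2.2.2.1 % (p.2.1 + 3)) p.1)) :=
    (rangeOf.comp (hB.pair hk)).congr fun _ => rfl
  -- the test at `ρ` (context, ρ)
  have hrow : CodeFP (pairE seedCtxE natE) natE (fun q =>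
      vvRowSumB q.1.1 q.1.2.1 q.1.2.2.1 (q.1.2.2.2.1 / (q.1.2.1 + 3)) q.2 q.1.2.2.2.2) :=
    (vvRowSumB_code.comp ((hB.comp (fst _ _)).pair ((hmu.comp (fst _ _)).pair ((hc.comp (fst _ _)).pair
      ((hr.comp (fst _ _)).pair ((snd _ _).pair (ha.comp (fst _ _)))))))).congr fun _ => rfl
  have htest : CodeFP (pairE seedCtxE natE) bitE (fun q =>
      decide (vvRowSumB q.1.1 q.1.2.1 q.1.2.2.1 (q.1.2.2.2.1 / (q.1.2.1 + 3)) q.2 q.1.2.2.2.2 % 2 = 0)) :=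
    (natEq.comp ((natMod.comp (hrow.pair (const _ (2 : ℕ)))).pair (const _ (0 : ℕ)))).congr fun _ => rfl
  have h := (all htest).comp ((CodeFP.id seedCtxE).pair hrange)
  exact h.congr fun _ => rfl

/-! ### Gate polynomials on codes -/

/-- The context of a gate polynomial: `(1^B, μ, T₀, table, c, wires)`. [folklore] -/
abbrev gateCtxE : ℕ × ℕ × ℕ × List (Bool × WireC) × ℕ × List WireC → List Bool :=
  pairE unE (pairE natE (pairE natE (pairE srcE (pairE natE (rawE wireE)))))

section gatectx

/-- Projections of the gate context. [folklore] -/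
theorem gB : CodeFP gateCtxE unE (fun p => p.1) := fst _ _
/-- Projections of the gate context. [folklore] -/
theorem gMu : CodeFP gateCtxE natE (fun p => p.2.1) := (snd _ _).fst'
/-- Projections of the gate context. [folklore] -/
theorem gT₀ : CodeFP gateCtxE natE (fun p => p.2.2.1) := (snd _ _).snd'.fst'
/-- Projections of the gate context. [folklore] -/
theorem gSrc : CodeFP gateCtxE srcE (fun p => p.2.2.2.1) := (snd _ _).snd'.snd'.fst'
/-- Projections of the gate context. [folklore] -/
theorem gC : CodeFP gateCtxE natE (fun p => p.2.2.2.2.1) := (snd _ _).snd'.snd'.snd'.fst'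
/-- Projections of the gate context. [folklore] -/
theorem gWs : CodeFP gateCtxE (rawE wireE) (fun p => p.2.2.2.2.2) := (snd _ _).snd'.snd'.snd'.snd'

/-- The literal tokens of the wire at position `a` (context, a). [folklore] -/
theorem litAt_code : CodeFP (pairE gateCtxE natE) toksE
    (fun q => litToksC q.1.2.2.2.1 q.1.2.2.2.2.1 (q.1.2.2.2.2.2.getD q.2 (0, 0))) :=
  (litToksC_code.comp ((gSrc.comp (fst _ _)).pair ((gC.comp (fst _ _)).pair
    ((rawGetOr wireE).comp ((gWs.comp (fst _ _)).pair ((snd _ _).pair (const _ ((0 : ℕ), (0 : ℕ))))))))).congr fun _ => rfl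

/-- The selected positions of test `t` (context, t). [folklore] -/
theorem selAt_code : CodeFP (pairE gateCtxE natE) (rawE natE)
    (fun q => (List.range q.1.2.2.2.2.2.length).filter fun a => vvSeedB q.1.1 q.1.2.1 q.1.2.2.2.2.1 q.2 a) := by
  have hpred : CodeFP (pairE (pairE gateCtxE natE) natE) bitE
      (fun u => vvSeedB u.1.1.1 u.1.1.2.1 u.1.1.2.2.2.2.1 u.1.2 u.2) :=
    (vvSeedB_code.comp (((gB.comp (fst _ _)).comp (fst _ _)).pair (((gMu.comp (fst _ _)).comp (fst _ _)).pair
      (((gC.comp (fst _ _)).comp (fst _ _)).pair (((snd _ _).comp (fst _ _)).pair (snd _ _)))))).congr fun _ => rfl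
  have hrange : CodeFP (pairE gateCtxE natE) (rawE natE) (fun q => List.range q.1.2.2.2.2.2.length) :=
    (urange.comp ((ulength wireE).comp (gWs.comp (fst _ _)))).congr fun _ => rfl
  exact ((filter hpred).comp ((CodeFP.id _).pair hrange)).congr fun _ => rfl

/-- **`andToksB` on codes.** [folklore] -/
theorem andToksB_code : CodeFP gateCtxE toksE (fun p => andToksB p.1 p.2.1 p.2.2.1 p.2.2.2.1 p.2.2.2.2.1 p.2.2.2.2.2) := by
  -- per test t: the summands over the selected positions
  have hlit2 : CodeFP (pairE (pairE gateCtxE natE) natE) toksE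
      (fun u => oneSubToks (litToksC u.1.1.2.2.2.1 u.1.1.2.2.2.2.1 (u.1.1.2.2.2.2.2.getD u.2 (0, 0)))) :=
    (oneSubToks_code.comp (litAt_code.comp (((fst _ _).comp (fst _ _)).pair (snd _ _)))).congr fun _ => rfl
  have hinner : CodeFP (pairE gateCtxE natE) toksE (fun q => oneSubToks (sumLToks
      (((List.range q.1.2.2.2.2.2.length).filter fun a => vvSeedB q.1.1 q.1.2.1 q.1.2.2.2.2.1 q.2 a).map fun a =>
        oneSubToks (litToksC q.1.2.2.2.1 q.1.2.2.2.2.1 (q.1.2.2.2.2.2.getD a (0, 0)))))) :=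
    (oneSubToks_code.comp (sumLToks_code.comp ((map hlit2).comp ((CodeFP.id _).pair selAt_code)))).congr fun _ => rfl
  have hrange : CodeFP gateCtxE (rawE natE) (fun p => List.range (min p.2.2.1 p.1)) := (rangeOf.comp (gB.pair gT₀)).congr fun _ => rfl
  have h := prodLToks_code.comp ((map hinner).comp ((CodeFP.id _).pair hrange))
  exact h.congr fun p => rfl

/-- **`orToksB` on codes.** [folklore] -/
theorem orToksB_code : CodeFP gateCtxE toksE (fun p => orToksB p.1 p.2.1 p.2.2.1 p.2.2.2.1 p.2.2.2.2.1 p.2.2.2.2.2) := by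
  have hlit2 : CodeFP (pairE (pairE gateCtxE natE) natE) toksE
      (fun u => litToksC u.1.1.2.2.2.1 u.1.1.2.2.2.2.1 (u.1.1.2.2.2.2.2.getD u.2 (0, 0))) :=
    (litAt_code.comp (((fst _ _).comp (fst _ _)).pair (snd _ _))).congr fun _ => rfl
  have hinner : CodeFP (pairE gateCtxE natE) toksE (fun q => oneSubToks (sumLToks
      (((List.range q.1.2.2.2.2.2.length).filter fun a => vvSeedB q.1.1 q.1.2.1 q.1.2.2.2.2.1 q.2 a).map fun a =>
        litToksC q.1.2.2.2.1 q.1.2.2.2.2.1 (q.1.2.2.2.2.2.getD a (0, 0))))) :=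
    (oneSubToks_code.comp (sumLToks_code.comp ((map hlit2).comp ((CodeFP.id _).pair selAt_code)))).congr fun _ => rfl
  have hrange : CodeFP gateCtxE (rawE natE) (fun p => List.range (min p.2.2.1 p.1)) := (rangeOf.comp (gB.pair gT₀)).congr fun _ => rfl
  have h := oneSubToks_code.comp (prodLToks_code.comp ((map hinner).comp ((CodeFP.id _).pair hrange)))
  exact h.congr fun p => rfl

end gatectx

/-- A list of token strings indexed by a fixed list of numerals, each computed from `(c, j)`. [folklore] -/
theorem mapConst_code {δ : Type} {eδ : δ → List Bool} (F : ℕ → δ → List Tok)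
    (hF : ∀ p : ℕ, CodeFP eδ toksE (F p)) :
    ∀ l : List ℕ, CodeFP eδ (rawE toksE) (fun x => l.map fun p => F p x)
  | [] => const _ []
  | p :: l => ((rawCons toksE).comp ((hF p).pair (mapConst_code F hF l))).congr fun _ => rfl

/-- **`modToksC m` on codes** (`c`, `j`). [folklore] -/
theorem modToksC_code (m : ℕ) : CodeFP (pairE natE natE) toksE (fun p => modToksC m p.1 p.2) := by
  have hitem : ∀ p : ℕ, CodeFP (pairE natE natE) toksE (fun x : ℕ × ℕ => oneSubToks [Tok.gv x.1 x.2 p]) := fun p =>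
    (oneSubToks_code.comp ((rawSingleton tokE).comp (tokGv_code.comp ((fst _ _).pair ((snd _ _).pair (const _ p)))))).congr
      fun _ => rfl
  have h := oneSubToks_code.comp (prodLToks_code.comp (mapConst_code (fun p (x : ℕ × ℕ) => oneSubToks [Tok.gv x.1 x.2 p])
    hitem (primesL m)))
  exact h.congr fun _ => rfl

/-! ### `q`-subsets by the front recursion -/

/-- The `(q+1)`-subsets of `l` from the `q`-subsets of its suffixes: for the positions `i` from the
back, `l[i]` in front of every `q`-subset behind `i`. [folklore] -/
def sublF (q : ℕ) (l : List ℕ) : List (List ℕ) :=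
  ((List.range l.length).map fun i => l.length - 1 - i).flatMap fun i =>
    ((l.drop (i + 1)).sublistsLen q).map (l.getD i 0 :: ·)

/-- One more element in front. [folklore] -/
theorem sublF_cons (q a : ℕ) (l : List ℕ) : sublF q (a :: l) = sublF q l ++ (l.sublistsLen q).map (a :: ·) := by
  have hidx : (List.range (a :: l).length).map (fun i => (a :: l).length - 1 - i) =
      ((List.range l.length).map fun i => l.length - 1 - i).map (· + 1) ++ [0] := by
    rw [List.length_cons, List.range_succ, List.map_append, List.map_singleton, List.map_map]
    congr 1
    · refine List.map_congr_left fun i hi => ?_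
      rw [List.mem_range] at hi
      show l.length + 1 - 1 - i = l.length - 1 - i + 1
      omega
    · simp
  rw [sublF, hidx, List.flatMap_append, List.flatMap_singleton, List.flatMap_map, sublF]
  rfl

/-- **`sublistsLen` by peeling the front**: the recursion
`sublistsLen (q+1) (a :: l) = sublistsLen (q+1) l ++ (sublistsLen q l).map (a :: ·)` unrolled. [folklore] -/
theorem sublistsLen_succ_eq (q : ℕ) : ∀ l : List ℕ, l.sublistsLen (q + 1) = sublF q l
  | [] => by simp [sublF, List.sublistsLen_succ_nil]
  | a :: l => by rw [List.sublistsLen_succ_cons, sublistsLen_succ_eq q l, sublF_cons]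

/-- **`sublistsLen q` on codes**, for a numeral `q`. [folklore] -/
theorem sublistsLen_code : ∀ q : ℕ, CodeFP (rawE natE) (rawE (rawE natE)) (fun l : List ℕ => l.sublistsLen q)
  | 0 => (const (rawE natE) [([] : List ℕ)]).congr fun l => (List.sublistsLen_zero l).symm
  | q + 1 => by
    have hl : CodeFP (pairE (rawE natE) natE) (rawE natE) (fun t => t.1) := fst _ _
    have hi : CodeFP (pairE (rawE natE) natE) natE (fun t => t.2) := snd _ _
    have hlen : CodeFP (pairE (rawE natE) natE) unE (fun t => t.1.length) := ((ulength natE).comp hl).congr fun _ => rfl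
    -- `drop (i+1)` through the unary budget `|l|`
    have hcnt : CodeFP (pairE (rawE natE) natE) unE (fun t => min (t.2 + 1) t.1.length) :=
      (unOfNatMin.comp (hlen.pair (natAdd.comp (hi.pair (const _ (1 : ℕ)))))).congr fun _ => rfl
    have hdrop : CodeFP (pairE (rawE natE) natE) (rawE natE) (fun t => t.1.drop (t.2 + 1)) :=
      ((rawDropUn natE).comp (hcnt.pair hl)).congr fun t => by
        show t.1.drop (min (t.2 + 1) t.1.length) = t.1.drop (t.2 + 1)
        rcases le_total (t.2 + 1) t.1.length with h | h
        · rw [min_eq_left h]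
        · rw [min_eq_right h, List.drop_of_length_le le_rfl, List.drop_of_length_le h]
    have hsub : CodeFP (pairE (rawE natE) natE) (rawE (rawE natE)) (fun t => (t.1.drop (t.2 + 1)).sublistsLen q) :=
      ((sublistsLen_code q).comp hdrop).congr fun _ => rfl
    have hhead : CodeFP (pairE (rawE natE) natE) natE (fun t => t.1.getD t.2 0) := rawGetD natE (d := 0) rfl
    have hcons : CodeFP (pairE (pairE (rawE natE) natE) (rawE natE)) (rawE natE) (fun u => u.1.1.getD u.1.2 0 :: u.2) :=
      ((rawCons natE).comp ((hhead.comp (fst _ _)).pair (snd _ _))).congr fun _ => rfl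
    have hterm : CodeFP (pairE (rawE natE) natE) (rawE (rawE natE))
        (fun t => ((t.1.drop (t.2 + 1)).sublistsLen q).map (t.1.getD t.2 0 :: ·)) :=
      ((map hcons).comp ((CodeFP.id _).pair hsub)).congr fun _ => rfl
    -- the positions from the back
    have hidx1 : CodeFP (pairE (rawE natE) natE) natE (fun t => t.1.length - 1 - t.2) :=
      (natSub.comp ((natSub.comp (((natLength natE).comp hl).pair (const _ (1 : ℕ)))).pair hi)).congr fun _ => rfl
    have hidx : CodeFP (rawE natE) (rawE natE) (fun l => (List.range l.length).map fun i => l.length - 1 - i) :=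
      ((map hidx1).comp ((CodeFP.id _).pair (urange.comp (ulength natE)))).congr fun _ => rfl
    have h := (flatten (rawE natE)).comp ((map hterm).comp ((CodeFP.id _).pair hidx))
    exact h.congr fun l => by rw [sublistsLen_succ_eq q l]; rfl

/-! ### Elementary symmetric and auxiliary polynomials on codes -/

/-- The context of the auxiliary polynomials: `(table, c, wires)`. [folklore] -/
abbrev auxCtxE : List (Bool × WireC) × ℕ × List WireC → List Bool := pairE srcE (pairE natE (rawE wireE))

/-- **`esymToksC` on codes**, for a numeral `q`. [folklore] -/
theorem esymToksC_code (q : ℕ) : CodeFP auxCtxE toksE (fun p => esymToksC p.1 p.2.1 p.2.2 q) := by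
  have hsrc : CodeFP auxCtxE srcE (fun p => p.1) := fst _ _
  have hc : CodeFP auxCtxE natE (fun p => p.2.1) := (snd _ _).fst'
  have hws : CodeFP auxCtxE (rawE wireE) (fun p => p.2.2) := (snd _ _).snd'
  have hlit : CodeFP (pairE auxCtxE natE) toksE (fun u => litToksC u.1.1 u.1.2.1 (u.1.2.2.getD u.2 (0, 0))) :=
    (litToksC_code.comp ((hsrc.comp (fst _ _)).pair ((hc.comp (fst _ _)).pair ((rawGetOr wireE).comp
      ((hws.comp (fst _ _)).pair ((snd _ _).pair (const _ ((0 : ℕ), (0 : ℕ))))))))).congr fun _ => rfl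
  have hA : CodeFP (pairE auxCtxE (rawE natE)) toksE
      (fun t => prodLToks (t.2.map fun a => litToksC t.1.1 t.1.2.1 (t.1.2.2.getD a (0, 0)))) :=
    (prodLToks_code.comp (map hlit)).congr fun _ => rfl
  have hsubs : CodeFP auxCtxE (rawE (rawE natE)) (fun p => (List.range p.2.2.length).sublistsLen q) :=
    ((sublistsLen_code q).comp (urange.comp ((ulength wireE).comp hws))).congr fun _ => rfl
  have h := sumLToks_code.comp ((map hA).comp ((CodeFP.id _).pair hsubs))
  exact h.congr fun _ => rfl

/-- The factors of `auxToksC` for a numeral prime `p`, over a fixed list of exponents. [folklore] -/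
theorem auxFactors_code (p : ℕ) : ∀ ts : List ℕ, CodeFP auxCtxE (rawE toksE)
    (fun x => ts.map fun t => oneSubToks (powToks (p - 1) (esymToksC x.1 x.2.1 x.2.2 (p ^ t))))
  | [] => const _ []
  | t :: ts => ((rawCons toksE).comp ((oneSubToks_code.comp ((powToks_code (p - 1)).comp (esymToksC_code (p ^ t)))).pair
      (auxFactors_code p ts))).congr fun _ => rfl

/-- `auxToksC m · · · p` on codes, for a numeral `p`. [folklore] -/
theorem auxToksC_const_code (m p : ℕ) : CodeFP auxCtxE toksE (fun x => auxToksC m x.1 x.2.1 x.2.2 p) :=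
  (oneSubToks_code.comp (prodLToks_code.comp (auxFactors_code p (List.range (m.factorization p))))).congr fun _ => rfl

/-- The exponent of a non-factor is `0`. [folklore] -/
theorem factorization_eq_zero_of_not_mem_primesL {m p : ℕ} (hp : p ∉ primesL m) : m.factorization p = 0 := by
  rw [mem_primesL] at hp
  exact Finsupp.notMem_support_iff.1 (by rwa [Nat.support_factorization])

/-- **`auxToksC m` on codes** with the prime as data: a case distinction over the prime factors of
`m`. [folklore] -/
theorem auxToksC_code (m : ℕ) : CodeFP (pairE auxCtxE natE) toksE (fun x => auxToksC m x.1.1 x.1.2.1 x.1.2.2 x.2) := by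
  have key : ∀ l : List ℕ, CodeFP (pairE auxCtxE natE) toksE (fun x =>
      if x.2 ∈ l then auxToksC m x.1.1 x.1.2.1 x.1.2.2 x.2 else oneSubToks (prodLToks [])) := by
    intro l
    induction l with
    | nil => exact (const _ (oneSubToks (prodLToks []))).congr fun x => by simp
    | cons p l ih =>
      have hp := (auxToksC_const_code m p).comp (fst auxCtxE natE)
      have hc := natEq.comp ((snd auxCtxE natE).pair (const _ p))
      exact (hc.ite hp ih).congr fun x => by
        by_cases h : x.2 = p
        · subst h; simp
        · simp [h]
  refine (key (primesL m)).congr fun x => ?_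
  split_ifs with h
  · rfl
  · rw [auxToksC, factorization_eq_zero_of_not_mem_primesL h]; rfl

/-! ### The tokens of the defining polynomials on codes -/

/-- The context of `ffToksB`: `(1^B, μ, T₀, gate codes, table)` and the variable `(c, j, q)`. [folklore] -/
abbrev ffCtxE : (ℕ × ℕ × ℕ × List GateC × List (Bool × WireC)) × ℕ × ℕ × ℕ → List Bool :=
  pairE (pairE unE (pairE natE (pairE natE (pairE (rawE gateE) srcE)))) (pairE natE (pairE natE natE))

/-- **`ffToksB` on codes.** [folklore] -/
theorem ffToksB_code (m : ℕ) :
    CodeFP ffCtxE toksE (fun x => ffToksB x.1.1 m x.1.2.1 x.1.2.2.1 x.1.2.2.2.1 x.1.2.2.2.2 x.2.1 x.2.2.1 x.2.2.2) := by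
  have hB : CodeFP ffCtxE unE (fun x => x.1.1) := (fst _ _).fst'
  have hmu : CodeFP ffCtxE natE (fun x => x.1.2.1) := (fst _ _).snd'.fst'
  have hT₀ : CodeFP ffCtxE natE (fun x => x.1.2.2.1) := (fst _ _).snd'.snd'.fst'
  have hgs : CodeFP ffCtxE (rawE gateE) (fun x => x.1.2.2.2.1) := (fst _ _).snd'.snd'.snd'.fst'
  have hsrc : CodeFP ffCtxE srcE (fun x => x.1.2.2.2.2) := (fst _ _).snd'.snd'.snd'.snd'
  have hc : CodeFP ffCtxE natE (fun x => x.2.1) := (snd _ _).fst'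
  have hj : CodeFP ffCtxE natE (fun x => x.2.2.1) := (snd _ _).snd'.fst'
  have hq : CodeFP ffCtxE natE (fun x => x.2.2.2) := (snd _ _).snd'.snd'
  have hg : CodeFP ffCtxE gateE (fun x => x.1.2.2.2.1.getD x.2.2.1 (0, [])) :=
    ((rawGetOr gateE).comp (hgs.pair (hj.pair (const _ ((0 : ℕ), ([] : List WireC)))))).congr fun _ => rfl
  have hctx : CodeFP ffCtxE gateCtxE (fun x => (x.1.1, x.1.2.1, x.1.2.2.1, x.1.2.2.2.2, x.2.1, (x.1.2.2.2.1.getD x.2.2.1 (0, [])).2)) :=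
    (hB.pair (hmu.pair (hT₀.pair (hsrc.pair (hc.pair hg.snd'))))).congr fun _ => rfl
  have hand := andToksB_code.comp hctx
  have hor := orToksB_code.comp hctx
  have hmod := (modToksC_code m).comp (hc.pair hj)
  have haux := (auxToksC_code m).comp ((hsrc.pair (hc.pair hg.snd')).pair hq)
  have hlen : CodeFP ffCtxE natE (fun x => x.1.2.2.2.1.length) := ((natLength gateE).comp hgs).congr fun _ => rfl
  have h := (natLt.comp (hj.pair hlen)).ite
    ((natEq.comp (hq.pair (const _ (0 : ℕ)))).ite
      ((natEq.comp (hg.fst'.pair (const _ (1 : ℕ)))).ite hand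
        ((natEq.comp (hg.fst'.pair (const _ (2 : ℕ)))).ite hor hmod))
      haux)
    (const _ [Tok.cst 0])
  exact h.congr fun x => by simp [ffToksB]

end BT

end Literature.Computability.Complexity
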